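import Literature.AlgebraicGeometry.HodgeTheory.ComplexConjugation
import HarnessLib

/-!
# The real structure of `Hᵏ(Y; ℂ) = Hᵏ(Y; ℝ) ⊗ ℂ`: change of coefficients along additive maps

Family `hodge`, layer `Literature/AlgebraicGeometry/HodgeTheory`. Companion to `RationalLattice`
(`ofRatCochain`, `cocycleOfRat`: change of coefficients `ℚ → ℂ` on the tree's singular cochains)
and `ComplexConjugation` (`conjClass`: complex conjugation of the values of cochains). Both are
instances of ONE construction, carried out here once: an additive map of coefficient groups
`g : A →+ B` induces `Cᵏ(Y; A) →+ Cᵏ(Y; B)` commuting with the coboundary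
(`δφ(σ) = ∑ (-1)ⁱ φ(σ|[v₀,…,v̂ᵢ,…])` has integer coefficients; Hatcher 2002, §3.1 p. 198: "a
homomorphism of coefficient groups induces a cochain map"), hence additive maps on cocycles and
on classes `Hᵏ(Y; A) →+ Hᵏ(Y; B)`, natural in `Y` and functorial in `g` — for cochain complexes
over DIFFERENT base rings (`singularCochainComplex R A Y`, `singularCochainComplex S B Y`), which
the tree's `singularCohomology.mapCoeff` (`AlgebraicTopology/SingularHomology/Coefficients`,
`R`-linear maps over one ring `R`, via Mathlib's functoriality in the coefficient object) does
not cover: the real part `re : ℂ → ℝ` is not `ℂ`-linear.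

Applied to `ℝ ↪ ℂ`, `re`, `im : ℂ → ℝ` this gives the **real structure** of complex singular
cohomology used by Hodge theory (Voisin I, §6.1.3, Cor. 6.12: "complex conjugation acts
naturally on `Hᵏ(X, ℂ) = Hᵏ(X, ℝ) ⊗ ℂ`"): `ofRealClass : Hᵏ(Y; ℝ) →+ Hᵏ(Y; ℂ)`,
`reClass`, `imClass : Hᵏ(Y; ℂ) →+ Hᵏ(Y; ℝ)` with `re (a ⊗ 1) = a`, `im (a ⊗ 1) = 0`,
`c = (re c) ⊗ 1 + i • (im c) ⊗ 1` (so `Hᵏ(Y; ℂ) = Hᵏ(Y; ℝ) ⊕ i Hᵏ(Y; ℝ) = Hᵏ(Y; ℝ) ⊗ ℂ`, all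
PROVED, for every space `Y` — universal coefficients for the free extension `ℝ → ℂ = ℝ²` needs no
`Tor`), and the link with `conjClass`: `conj c = (re c) ⊗ 1 - i • (im c) ⊗ 1`, i.e. `conjClass`
IS the conjugation of `Hᵏ(Y; ℝ) ⊗ ℂ` on the second factor (Voisin's "acts naturally").

Consumer: the complexification of a real de Rham isomorphism family
(`HodgeTheory/ComplexifiedDeRhamFamily`), which derives the named fact
`exists_isReal_complexDeRhamIsoFamily` (`ComplexConjugationProofs`) from the REAL de Rham theorem
`Literature.NumberTheory.Transcendental.exists_deRhamIsoFamily`.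

## Main definitions and statements (all proved)

* `coeffCochain g k`, `coeffCocycle g k`, `coeffClass g k : Hᵏ(Y; A) →+ Hᵏ(Y; B)` for
  `g : A →+ B`; `coeffClass_π` (`[z] ↦ [g ∘ z]`), `coeffClass_map` (natural in `Y`),
  `coeffClass_comp`, `coeffClass_id`, `coeffClass_hom_add`, `coeffClass_hom_zero`,
  `smul_coeffClass`, `coeffClass_smul` (functorial and bilinear in `g`);
  `conjClass_eq_coeffClass` (consistency with `ComplexConjugation`).
* `ofRealClass`, `reClass`, `imClass`; `reClass_ofRealClass`, `imClass_ofRealClass`,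
  `ofRealClass_reClass_add_I_smul` (`c = re c ⊗ 1 + i • im c ⊗ 1`), `reClass_smul`,
  `imClass_smul`, `ofRealClass_smul`, `ext_reClass_imClass`, `ofRealClass_injective`,
  `conjClass_ofRealClass`, `conjClass_eq_reClass_sub_imClass`, `reClass_conjClass`,
  `imClass_conjClass`, naturality `ofRealClass_map`, `reClass_map`, `imClass_map`.

## References

* A. Hatcher, *Algebraic Topology* (2002), §3.1 (p. 191 `δ`, p. 198 change of coefficients),
  §3.A (universal coefficients for a field extension).
* C. Voisin, *Hodge Theory and Complex Algebraic Geometry I* (2002), §6.1.3 Cor. 6.12.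
-/

noncomputable section

open CategoryTheory

universe u v

namespace Literature.AlgebraicGeometry.HodgeTheory

section HodgeTheory

-- the cochain modules of `singularCochainComplex` are function types up to unfolding
set_option backward.isDefEq.respectTransparency false

open Literature.AlgebraicTopology.SingularHomology singularCochainComplex

variable {Y : Type u} [TopologicalSpace Y]

/-! ### Change of coefficients along an additive map -/

section Coeff

variable {R S T : Type v} [CommRing R] [CommRing S] [CommRing T]
  {A B C : Type v} [AddCommGroup A] [Module R A] [AddCommGroup B] [Module S B]
  [AddCommGroup C] [Module T C]

/-- **Change of coefficients on cochains** along an additive map `g : A →+ B` of coefficient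
groups, `Cᵏ(Y; A) →+ Cᵏ(Y; B)`, `φ ↦ g ∘ φ` (the cochain rings `R`, `S` may differ).
[cite: HatcherAT2002, §3.1 p. 198] -/
def coeffCochain (g : A →+ B) (k : ℕ) :
    (singularCochainComplex R A Y).X k →+ (singularCochainComplex S B Y).X k where
  toFun φ σ := g (φ σ)
  map_zero' := singularCochainComplex.ext fun σ ↦ by
    change g 0 = 0
    exact map_zero g
  map_add' φ ψ := singularCochainComplex.ext fun σ ↦ by
    change g (φ σ + ψ σ) = g (φ σ) + g (ψ σ)
    exact map_add g _ _

/-- Pointwise formula (definitional). [folklore] -/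
@[simp]
theorem coeffCochain_apply (g : A →+ B) {k : ℕ} (φ : (singularCochainComplex R A Y).X k)
    (σ : SingularSimplex Y k) :
    coeffCochain (R := R) (S := S) g k φ σ = g (φ σ) :=
  rfl

/-- **Change of coefficients commutes with the coboundary**: `δ (g ∘ φ) = g ∘ δφ`, because
`δφ(σ) = ∑ (-1)ⁱ φ(σ ∘ δᵢ)` has integer coefficients. [cite: HatcherAT2002, §3.1 p. 191] -/
theorem d_coeffCochain (g : A →+ B) {k : ℕ} (φ : (singularCochainComplex R A Y).X k) :
    (singularCochainComplex S B Y).d k (k + 1) (coeffCochain (R := R) g k φ) =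
      coeffCochain (R := R) g (k + 1) ((singularCochainComplex R A Y).d k (k + 1) φ) := by
  refine singularCochainComplex.ext fun σ ↦ ?_
  rw [coeffCochain_apply, d_apply, d_apply, map_sum]
  refine Finset.sum_congr rfl fun i _ ↦ ?_
  change ((-1 : S) ^ (i : ℕ)) • g (φ (σ.face i)) = g (((-1 : R) ^ (i : ℕ)) • φ (σ.face i))
  obtain h | h := Nat.even_or_odd (i : ℕ)
  · rw [h.neg_one_pow, h.neg_one_pow, one_smul, one_smul]
  · rw [h.neg_one_pow, h.neg_one_pow, neg_smul, neg_smul, one_smul, one_smul, map_neg]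

/-- `g ∘ z` is a cocycle for a cocycle `z`. [cite: HatcherAT2002, §3.1 p. 198] -/
theorem d_coeffCochain_iCocycles (g : A →+ B) {k : ℕ} (z : cocycles R A Y k) :
    (singularCochainComplex S B Y).d k (k + 1)
      (coeffCochain (R := R) g k (iCocycles R A Y k z)) = 0 := by
  rw [d_coeffCochain, d_iCocycles, map_zero]

/-- **Change of coefficients on cocycles**, `Zᵏ(Y; A) →+ Zᵏ(Y; B)`.
[cite: HatcherAT2002, §3.1 p. 198] -/
def coeffCocycle (g : A →+ B) (k : ℕ) : cocycles R A Y k →+ cocycles S B Y k where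
  toFun z := cocyclesMk (coeffCochain (R := R) g k (iCocycles R A Y k z))
    (d_coeffCochain_iCocycles g z)
  map_zero' := cocycles_ext (by rw [iCocycles_mk, map_zero, map_zero, map_zero])
  map_add' z z' := cocycles_ext (by rw [iCocycles_mk, map_add, map_add, map_add, iCocycles_mk,
    iCocycles_mk])

/-- The underlying cochain of `coeffCocycle g k z` is `g ∘ z`. [folklore] -/
@[simp]
theorem iCocycles_coeffCocycle (g : A →+ B) {k : ℕ} (z : cocycles R A Y k) :
    iCocycles S B Y k (coeffCocycle (R := R) g k z) =
      coeffCochain (R := R) g k (iCocycles R A Y k z) :=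
  iCocycles_mk _ (d_coeffCochain_iCocycles g z)

/-- Change of coefficients of a coboundary is a coboundary: `g ∘ δy = δ (g ∘ y)`.
[cite: HatcherAT2002, §3.1 p. 191] -/
theorem coeffCocycle_toCocycles (g : A →+ B) {k : ℕ} (y : (singularCochainComplex R A Y).X k) :
    coeffCocycle (R := R) (S := S) g (k + 1) (toCocycles R A Y k (k + 1) y) =
      toCocycles S B Y k (k + 1) (coeffCochain (R := R) g k y) :=
  cocycles_ext (by rw [iCocycles_coeffCocycle, iCocycles_toCocycles, iCocycles_toCocycles,
    d_coeffCochain])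

/-- Change of coefficients passes to classes: cohomologous cocycles have cohomologous images.
[cite: HatcherAT2002, §3.1 p. 198] -/
theorem π_coeffCocycle_eq_of_π_eq (g : A →+ B) {k : ℕ} {z z' : cocycles R A Y k}
    (h : singularCohomology.π R A Y k z = singularCohomology.π R A Y k z') :
    singularCohomology.π S B Y k (coeffCocycle (R := R) g k z) =
      singularCohomology.π S B Y k (coeffCocycle (R := R) g k z') := by
  rw [← sub_eq_zero, ← map_sub] at h
  rw [← sub_eq_zero, ← map_sub, ← map_sub]
  cases k with
  | zero => rw [cocycles_eq_zero_of_π_eq_zero R A _ h, map_zero, map_zero]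
  | succ k =>
    obtain ⟨y, hy⟩ := exists_toCocycles_eq_of_π_eq_zero R A _ h
    rw [← hy, coeffCocycle_toCocycles, π_toCocycles]

/-- The class of `g ∘ z` for any cocycle `z` representing `c` (auxiliary unbundled function;
see `coeffClass`). [cite: HatcherAT2002, §3.1 p. 198] -/
def coeffClassFun (g : A →+ B) (k : ℕ) (c : singularCohomology R A Y k) :
    singularCohomology S B Y k :=
  singularCohomology.π S B Y k (coeffCocycle (R := R) g k
    (((ModuleCat.epi_iff_surjective _).1 (inferInstance : Epi (singularCohomology.π R A Y k))
      c).choose))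

/-- `coeffClassFun g k [z] = [g ∘ z]`. [cite: HatcherAT2002, §3.1 p. 198] -/
theorem coeffClassFun_π (g : A →+ B) {k : ℕ} (z : cocycles R A Y k) :
    coeffClassFun (S := S) g k (singularCohomology.π R A Y k z) =
      singularCohomology.π S B Y k (coeffCocycle (R := R) g k z) :=
  π_coeffCocycle_eq_of_π_eq g (((ModuleCat.epi_iff_surjective _).1
    (inferInstance : Epi (singularCohomology.π R A Y k))
    (singularCohomology.π R A Y k z)).choose_spec)

/-- **Change of coefficients on cohomology** along an additive map `g : A →+ B`:
`Hᵏ(Y; A) →+ Hᵏ(Y; B)`, `[z] ↦ [g ∘ z]` (`coeffClass_π`). [cite: HatcherAT2002, §3.1 p. 198] -/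
def coeffClass (g : A →+ B) (k : ℕ) : singularCohomology R A Y k →+ singularCohomology S B Y k where
  toFun := coeffClassFun g k
  map_zero' := by
    rw [← (singularCohomology.π R A Y k).hom.map_zero]
    change coeffClassFun g k (singularCohomology.π R A Y k 0) = 0
    rw [coeffClassFun_π, map_zero, map_zero]
  map_add' c c' := by
    induction c using singularCohomology_induction_on with
    | h z =>
      induction c' using singularCohomology_induction_on with
      | h z' => rw [← map_add, coeffClassFun_π, coeffClassFun_π, coeffClassFun_π, map_add, map_add]

/-- **`coeffClass g k [z] = [g ∘ z]`.** [cite: HatcherAT2002, §3.1 p. 198] -/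
theorem coeffClass_π (g : A →+ B) {k : ℕ} (z : cocycles R A Y k) :
    coeffClass (S := S) g k (singularCohomology.π R A Y k z) =
      singularCohomology.π S B Y k (coeffCocycle (R := R) g k z) :=
  coeffClassFun_π g z

/-- **Naturality in the space**: `g_* (f^* c) = f^* (g_* c)` for a continuous map `f` (both are
computed on cochains by `φ ↦ g ∘ φ ∘ f_♯`). [cite: HatcherAT2002, §3.1 p. 198] -/
theorem coeffClass_map (g : A →+ B) {Y' : Type u} [TopologicalSpace Y'] (f : C(Y', Y)) {k : ℕ}
    (c : singularCohomology R A Y k) :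
    coeffClass (S := S) g k (singularCohomology.map R A f k c) =
      singularCohomology.map S B f k (coeffClass (S := S) g k c) := by
  induction c using singularCohomology_induction_on with
  | h z =>
    rw [singularCohomology.map_π, coeffClass_π, coeffClass_π, singularCohomology.map_π]
    exact congrArg _ (cocycles_ext (by
      rw [iCocycles_coeffCocycle, iCocycles_cocyclesMap, iCocycles_cocyclesMap,
        iCocycles_coeffCocycle]
      rfl))

/-- **Functoriality in the coefficient map**: `(g' ∘ g)_* = g'_* ∘ g_*`. [folklore] -/
theorem coeffClass_comp (g : A →+ B) (g' : B →+ C) {k : ℕ} (c : singularCohomology R A Y k) :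
    coeffClass (S := T) (g'.comp g) k c =
      coeffClass (R := S) (S := T) g' k (coeffClass (S := S) g k c) := by
  induction c using singularCohomology_induction_on with
  | h z =>
    rw [coeffClass_π, coeffClass_π, coeffClass_π]
    exact congrArg _ (cocycles_ext (by
      rw [iCocycles_coeffCocycle, iCocycles_coeffCocycle, iCocycles_coeffCocycle]
      rfl))

/-- The identity of coefficients induces the identity. [folklore] -/
@[simp]
theorem coeffClass_id {k : ℕ} (c : singularCohomology R A Y k) :
    coeffClass (S := R) (AddMonoidHom.id A) k c = c := by
  induction c using singularCohomology_induction_on with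
  | h z =>
    rw [coeffClass_π]
    exact congrArg _ (cocycles_ext (by rw [iCocycles_coeffCocycle]; rfl))

/-- Two coefficient maps that agree induce the same map (congruence for rewriting under the
binder). [folklore] -/
theorem coeffClass_congr {g g' : A →+ B} (h : ∀ a, g a = g' a) {k : ℕ}
    (c : singularCohomology R A Y k) :
    coeffClass (R := R) (S := S) g k c = coeffClass (R := R) (S := S) g' k c := by
  rw [AddMonoidHom.ext h]

/-- Additivity in the coefficient map: `(g + g')_* = g_* + g'_*`. [folklore] -/
theorem coeffClass_hom_add (g g' : A →+ B) {k : ℕ} (c : singularCohomology R A Y k) :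
    coeffClass (R := R) (S := S) (g + g') k c =
      coeffClass (S := S) g k c + coeffClass (S := S) g' k c := by
  induction c using singularCohomology_induction_on with
  | h z =>
    rw [coeffClass_π, coeffClass_π, coeffClass_π, ← map_add]
    exact congrArg _ (cocycles_ext (by
      rw [iCocycles_coeffCocycle, map_add, iCocycles_coeffCocycle, iCocycles_coeffCocycle]
      rfl))

/-- The zero coefficient map induces zero. [folklore] -/
@[simp]
theorem coeffClass_hom_zero {k : ℕ} (c : singularCohomology R A Y k) :
    coeffClass (R := R) (S := S) (0 : A →+ B) k c = 0 := by
  have h := coeffClass_hom_add (R := R) (S := S) (Y := Y) (0 : A →+ B) 0 c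
  rw [add_zero] at h
  exact left_eq_add.1 h

/-- `(-g)_* = -g_*`. [folklore] -/
theorem coeffClass_hom_neg (g : A →+ B) {k : ℕ} (c : singularCohomology R A Y k) :
    coeffClass (R := R) (S := S) (-g) k c = -coeffClass (S := S) g k c := by
  rw [eq_neg_iff_add_eq_zero, ← coeffClass_hom_add, neg_add_cancel, coeffClass_hom_zero]

/-- `(g - g')_* = g_* - g'_*`. [folklore] -/
theorem coeffClass_hom_sub (g g' : A →+ B) {k : ℕ} (c : singularCohomology R A Y k) :
    coeffClass (R := R) (S := S) (g - g') k c =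
      coeffClass (S := S) g k c - coeffClass (S := S) g' k c := by
  rw [sub_eq_add_neg, coeffClass_hom_add, coeffClass_hom_neg, ← sub_eq_add_neg]

/-- Scalars of the target act through the coefficient map: `s • g_* c = (s • g)_* c`, where
`(s • g) a = s • g a`. [folklore] -/
theorem smul_coeffClass (s : S) (g : A →+ B) {k : ℕ} (c : singularCohomology R A Y k) :
    s • coeffClass (R := R) (S := S) g k c =
      coeffClass (R := R) (S := S) ((DistribSMul.toAddMonoidHom B s).comp g) k c := by
  induction c using singularCohomology_induction_on with
  | h z =>
    rw [coeffClass_π, coeffClass_π, ← map_smul]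
    exact congrArg _ (cocycles_ext (by
      rw [map_smul (iCocycles S B Y k).hom, iCocycles_coeffCocycle, iCocycles_coeffCocycle]
      rfl))

/-- Scalars of the source pass through the coefficient map: `g_* (r • c) = (g ∘ (r • ·))_* c`.
[folklore] -/
theorem coeffClass_smul (g : A →+ B) (r : R) {k : ℕ} (c : singularCohomology R A Y k) :
    coeffClass (R := R) (S := S) g k (r • c) =
      coeffClass (R := R) (S := S) (g.comp (DistribSMul.toAddMonoidHom A r)) k c := by
  induction c using singularCohomology_induction_on with
  | h z =>
    rw [← map_smul, coeffClass_π, coeffClass_π]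
    exact congrArg _ (cocycles_ext (by
      rw [iCocycles_coeffCocycle, iCocycles_coeffCocycle, map_smul (iCocycles R A Y k).hom]
      rfl))

end Coeff

/-- **`conjClass` is the change of coefficients along complex conjugation** (consistency of
`ComplexConjugation.conjClass` with `coeffClass`). [cite: VoisinHodgeI2002, §6.1.3 Cor. 6.12] -/
theorem conjClass_eq_coeffClass {k : ℕ} (c : singularCohomology ℂ ℂ Y k) :
    conjClass Y k c = coeffClass (R := ℂ) (S := ℂ) (starRingEnd ℂ).toAddMonoidHom k c := by
  induction c using singularCohomology_induction_on with
  | h z =>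
    rw [conjClass_π, coeffClass_π]
    exact congrArg _ (cocycles_ext (by rw [iCocycles_conjCocycle, iCocycles_coeffCocycle]; rfl))

/-! ### The real structure: `ℝ ↪ ℂ`, real and imaginary parts -/

variable (Y) in
/-- **Complexification of real classes** `Hᵏ(Y; ℝ) →+ Hᵏ(Y; ℂ)`, `a ↦ a ⊗ 1`: change of
coefficients along `ℝ ↪ ℂ`. [cite: VoisinHodgeI2002, §6.1.3 Cor. 6.12] -/
def ofRealClass (k : ℕ) : singularCohomology ℝ ℝ Y k →+ singularCohomology ℂ ℂ Y k :=
  coeffClass (R := ℝ) (S := ℂ) Complex.ofRealHom.toAddMonoidHom k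

variable (Y) in
/-- **Real part of a complex class** `Hᵏ(Y; ℂ) →+ Hᵏ(Y; ℝ)`: change of coefficients along
`re : ℂ → ℝ` (the values of a cocycle are replaced by their real parts; `δ` has integer
coefficients). [cite: VoisinHodgeI2002, §6.1.3 Cor. 6.12] -/
def reClass (k : ℕ) : singularCohomology ℂ ℂ Y k →+ singularCohomology ℝ ℝ Y k :=
  coeffClass (R := ℂ) (S := ℝ) Complex.reAddGroupHom k

variable (Y) in
/-- **Imaginary part of a complex class** `Hᵏ(Y; ℂ) →+ Hᵏ(Y; ℝ)`: change of coefficients along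
`im : ℂ → ℝ`. [cite: VoisinHodgeI2002, §6.1.3 Cor. 6.12] -/
def imClass (k : ℕ) : singularCohomology ℂ ℂ Y k →+ singularCohomology ℝ ℝ Y k :=
  coeffClass (R := ℂ) (S := ℝ) Complex.imAddGroupHom k

/-- `ofRealClass [ζ] = [ofReal ∘ ζ]`. [folklore] -/
theorem ofRealClass_π {k : ℕ} (ζ : cocycles ℝ ℝ Y k) :
    ofRealClass Y k (singularCohomology.π ℝ ℝ Y k ζ) = singularCohomology.π ℂ ℂ Y k
      (coeffCocycle (R := ℝ) Complex.ofRealHom.toAddMonoidHom k ζ) :=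
  coeffClass_π _ ζ

/-- `reClass [z] = [re ∘ z]`. [folklore] -/
theorem reClass_π {k : ℕ} (z : cocycles ℂ ℂ Y k) :
    reClass Y k (singularCohomology.π ℂ ℂ Y k z) = singularCohomology.π ℝ ℝ Y k
      (coeffCocycle (R := ℂ) Complex.reAddGroupHom k z) :=
  coeffClass_π _ z

/-- `imClass [z] = [im ∘ z]`. [folklore] -/
theorem imClass_π {k : ℕ} (z : cocycles ℂ ℂ Y k) :
    imClass Y k (singularCohomology.π ℂ ℂ Y k z) = singularCohomology.π ℝ ℝ Y k
      (coeffCocycle (R := ℂ) Complex.imAddGroupHom k z) :=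
  coeffClass_π _ z

/-- **`re (a ⊗ 1) = a`.** [cite: VoisinHodgeI2002, §6.1.3 Cor. 6.12] -/
@[simp]
theorem reClass_ofRealClass {k : ℕ} (a : singularCohomology ℝ ℝ Y k) :
    reClass Y k (ofRealClass Y k a) = a := by
  rw [reClass, ofRealClass, ← coeffClass_comp]
  rw [coeffClass_congr (g' := AddMonoidHom.id ℝ) (fun x ↦ by simp), coeffClass_id]

/-- **`im (a ⊗ 1) = 0`.** [cite: VoisinHodgeI2002, §6.1.3 Cor. 6.12] -/
@[simp]
theorem imClass_ofRealClass {k : ℕ} (a : singularCohomology ℝ ℝ Y k) :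
    imClass Y k (ofRealClass Y k a) = 0 := by
  rw [imClass, ofRealClass, ← coeffClass_comp]
  rw [coeffClass_congr (g' := (0 : ℝ →+ ℝ)) (fun x ↦ by simp), coeffClass_hom_zero]

/-- **`c = (re c) ⊗ 1 + i • (im c) ⊗ 1`**: `Hᵏ(Y; ℂ) = Hᵏ(Y; ℝ) ⊗ ℂ` (universal coefficients
for the free extension `ℝ → ℂ`, on the nose). [cite: VoisinHodgeI2002, §6.1.3 Cor. 6.12] -/
theorem ofRealClass_reClass_add_I_smul {k : ℕ} (c : singularCohomology ℂ ℂ Y k) :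
    ofRealClass Y k (reClass Y k c) + Complex.I • ofRealClass Y k (imClass Y k c) = c := by
  rw [reClass, imClass, ofRealClass, ← coeffClass_comp, ← coeffClass_comp, smul_coeffClass,
    ← coeffClass_hom_add]
  conv_rhs => rw [← coeffClass_id (R := ℂ) c]
  refine coeffClass_congr (fun z ↦ ?_) c
  simp [Complex.re_add_im, mul_comm Complex.I]

/-- Two complex classes with the same real and imaginary parts are equal. [folklore] -/
theorem ext_reClass_imClass {k : ℕ} {c c' : singularCohomology ℂ ℂ Y k}
    (hre : reClass Y k c = reClass Y k c') (him : imClass Y k c = imClass Y k c') : c = c' := by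
  rw [← ofRealClass_reClass_add_I_smul c, ← ofRealClass_reClass_add_I_smul c', hre, him]

/-- `a ↦ a ⊗ 1` is injective (`re (a ⊗ 1) = a`). [folklore] -/
theorem ofRealClass_injective (k : ℕ) : Function.Injective (ofRealClass Y k) :=
  fun a a' h ↦ by rw [← reClass_ofRealClass a, h, reClass_ofRealClass]

/-- **Real part of a complex multiple**: `re (z • c) = Re z • re c - Im z • im c`.
[cite: VoisinHodgeI2002, §6.1.3 Cor. 6.12] -/
theorem reClass_smul {k : ℕ} (z : ℂ) (c : singularCohomology ℂ ℂ Y k) :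
    reClass Y k (z • c) = z.re • reClass Y k c - z.im • imClass Y k c := by
  rw [reClass, imClass, coeffClass_smul, smul_coeffClass, smul_coeffClass, ← coeffClass_hom_sub]
  refine coeffClass_congr (fun w ↦ ?_) c
  simp [Complex.mul_re]

/-- **Imaginary part of a complex multiple**: `im (z • c) = Re z • im c + Im z • re c`.
[cite: VoisinHodgeI2002, §6.1.3 Cor. 6.12] -/
theorem imClass_smul {k : ℕ} (z : ℂ) (c : singularCohomology ℂ ℂ Y k) :
    imClass Y k (z • c) = z.re • imClass Y k c + z.im • reClass Y k c := by
  rw [reClass, imClass, coeffClass_smul, smul_coeffClass, smul_coeffClass, ← coeffClass_hom_add]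
  refine coeffClass_congr (fun w ↦ ?_) c
  simp [Complex.mul_im]

/-- `re ((r : ℂ) • c) = r • re c` for real `r` (`re` is `ℝ`-linear). [folklore] -/
theorem reClass_real_smul {k : ℕ} (r : ℝ) (c : singularCohomology ℂ ℂ Y k) :
    reClass Y k ((r : ℂ) • c) = r • reClass Y k c := by
  rw [reClass_smul, Complex.ofReal_re, Complex.ofReal_im, zero_smul, sub_zero]

/-- `im ((r : ℂ) • c) = r • im c` for real `r` (`im` is `ℝ`-linear). [folklore] -/
theorem imClass_real_smul {k : ℕ} (r : ℝ) (c : singularCohomology ℂ ℂ Y k) :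
    imClass Y k ((r : ℂ) • c) = r • imClass Y k c := by
  rw [imClass_smul, Complex.ofReal_re, Complex.ofReal_im, zero_smul, add_zero]

/-- `re (i • c) = - im c`. [folklore] -/
theorem reClass_I_smul {k : ℕ} (c : singularCohomology ℂ ℂ Y k) :
    reClass Y k (Complex.I • c) = -imClass Y k c := by
  rw [reClass_smul, Complex.I_re, Complex.I_im, zero_smul, one_smul, zero_sub]

/-- `im (i • c) = re c`. [folklore] -/
theorem imClass_I_smul {k : ℕ} (c : singularCohomology ℂ ℂ Y k) :
    imClass Y k (Complex.I • c) = reClass Y k c := by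
  rw [imClass_smul, Complex.I_re, Complex.I_im, zero_smul, one_smul, zero_add]

/-- `(r • a) ⊗ 1 = (r : ℂ) • (a ⊗ 1)` (`ofRealClass` is `ℝ`-linear). [folklore] -/
theorem ofRealClass_smul {k : ℕ} (r : ℝ) (a : singularCohomology ℝ ℝ Y k) :
    ofRealClass Y k (r • a) = (r : ℂ) • ofRealClass Y k a := by
  rw [ofRealClass, coeffClass_smul, smul_coeffClass]
  refine coeffClass_congr (fun x ↦ ?_) a
  simp

/-- **Real classes are real**: `conj (a ⊗ 1) = a ⊗ 1`. [cite: VoisinHodgeI2002, §6.1.3 Cor. 6.12] -/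
@[simp]
theorem conjClass_ofRealClass {k : ℕ} (a : singularCohomology ℝ ℝ Y k) :
    conjClass Y k (ofRealClass Y k a) = ofRealClass Y k a := by
  rw [conjClass_eq_coeffClass, ofRealClass, ← coeffClass_comp]
  refine coeffClass_congr (fun x ↦ ?_) a
  simp

/-- **`conjClass` is the conjugation of `Hᵏ(Y; ℝ) ⊗ ℂ`**: `conj c = (re c) ⊗ 1 - i • (im c) ⊗ 1`
("complex conjugation acts naturally on `Hᵏ(X, ℂ) = Hᵏ(X, ℝ) ⊗ ℂ`").
[cite: VoisinHodgeI2002, §6.1.3 Cor. 6.12] -/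
theorem conjClass_eq_reClass_sub_imClass {k : ℕ} (c : singularCohomology ℂ ℂ Y k) :
    conjClass Y k c =
      ofRealClass Y k (reClass Y k c) - Complex.I • ofRealClass Y k (imClass Y k c) := by
  conv_lhs => rw [← ofRealClass_reClass_add_I_smul c]
  rw [conjClass_add, conjClass_smul, conjClass_ofRealClass, conjClass_ofRealClass, Complex.conj_I,
    neg_smul, sub_eq_add_neg]

/-- `re (conj c) = re c`. [cite: VoisinHodgeI2002, §6.1.3 Cor. 6.12] -/
@[simp]
theorem reClass_conjClass {k : ℕ} (c : singularCohomology ℂ ℂ Y k) :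
    reClass Y k (conjClass Y k c) = reClass Y k c := by
  rw [conjClass_eq_coeffClass, reClass, ← coeffClass_comp]
  exact coeffClass_congr (fun x ↦ by simp) c

/-- `im (conj c) = - im c`. [cite: VoisinHodgeI2002, §6.1.3 Cor. 6.12] -/
@[simp]
theorem imClass_conjClass {k : ℕ} (c : singularCohomology ℂ ℂ Y k) :
    imClass Y k (conjClass Y k c) = -imClass Y k c := by
  rw [conjClass_eq_coeffClass, imClass, ← coeffClass_comp, ← coeffClass_hom_neg]
  exact coeffClass_congr (fun x ↦ by simp) c

/-- A complex class is real (`conj c = c`) iff its imaginary part vanishes. [folklore] -/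
theorem conjClass_eq_self_iff_imClass_eq_zero {k : ℕ} (c : singularCohomology ℂ ℂ Y k) :
    conjClass Y k c = c ↔ imClass Y k c = 0 := by
  constructor
  · intro h
    have h2 := imClass_conjClass c
    rw [h, eq_neg_iff_add_eq_zero, ← two_smul ℝ] at h2
    exact (smul_eq_zero.1 h2).resolve_left two_ne_zero
  · intro h
    exact ext_reClass_imClass (reClass_conjClass c) (by rw [imClass_conjClass, h, neg_zero])

/-- A real class (`conj c = c`) is the complexification of its real part. [folklore] -/
theorem ofRealClass_reClass_of_conjClass_eq {k : ℕ} {c : singularCohomology ℂ ℂ Y k}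
    (h : conjClass Y k c = c) : ofRealClass Y k (reClass Y k c) = c := by
  conv_rhs => rw [← ofRealClass_reClass_add_I_smul c]
  rw [(conjClass_eq_self_iff_imClass_eq_zero c).1 h, map_zero, smul_zero, add_zero]

/-! ### Naturality in the space -/

variable {Y' : Type u} [TopologicalSpace Y'] (f : C(Y', Y)) {k : ℕ}

/-- `(f^* a) ⊗ 1 = f^* (a ⊗ 1)`. [cite: HatcherAT2002, §3.1 p. 198] -/
theorem ofRealClass_map (a : singularCohomology ℝ ℝ Y k) :
    ofRealClass Y' k (singularCohomology.map ℝ ℝ f k a) =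
      singularCohomology.map ℂ ℂ f k (ofRealClass Y k a) :=
  coeffClass_map _ f a

/-- `re (f^* c) = f^* (re c)`. [cite: HatcherAT2002, §3.1 p. 198] -/
theorem reClass_map (c : singularCohomology ℂ ℂ Y k) :
    reClass Y' k (singularCohomology.map ℂ ℂ f k c) =
      singularCohomology.map ℝ ℝ f k (reClass Y k c) :=
  coeffClass_map _ f c

/-- `im (f^* c) = f^* (im c)`. [cite: HatcherAT2002, §3.1 p. 198] -/
theorem imClass_map (c : singularCohomology ℂ ℂ Y k) :
    imClass Y' k (singularCohomology.map ℂ ℂ f k c) =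
      singularCohomology.map ℝ ℝ f k (imClass Y k c) :=
  coeffClass_map _ f c


/-! ### Appended (v2): the rational lattice through `coeffClass`

`RationalLattice.ofRatCochain` / `cocycleOfRat` (change of coefficients `ℚ → ℂ`) are instances of
`coeffCochain` / `coeffCocycle` (the module docstring's claim, made a theorem), and the class-level
map `ofRatClass : Hᵏ(Y; ℚ) →+ Hᵏ(Y; ℂ)` they induce is injective with image exactly the rational
classes (`RationalLattice.π_cocycleOfRat_eq_iff`, `isRationalClass_iff_exists_cocycleOfRat`, now at
the level of classes), factors through the real lattice (`ofRatClass = ofRealClass ∘ (ℚ → ℝ)`), and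
lands in the real classes (`im = 0`). -/

/-- `ofRatCochain` is the change of coefficients along `ℚ ↪ ℂ`. [folklore] -/
theorem ofRatCochain_eq_coeffCochain (k : ℕ) :
    ofRatCochain (Y := Y) k = coeffCochain (R := ℚ) (S := ℂ) (Rat.castHom ℂ).toAddMonoidHom k :=
  AddMonoidHom.ext fun _ ↦ singularCochainComplex.ext fun _ ↦ rfl

/-- `cocycleOfRat` is the change of coefficients along `ℚ ↪ ℂ` on cocycles. [folklore] -/
theorem cocycleOfRat_eq_coeffCocycle {k : ℕ} (ζ : cocycles ℚ ℚ Y k) :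
    cocycleOfRat Y k ζ = coeffCocycle (R := ℚ) (S := ℂ) (Rat.castHom ℂ).toAddMonoidHom k ζ :=
  cocycles_ext (by
    rw [iCocycles_cocycleOfRat, iCocycles_coeffCocycle, ofRatCochain_eq_coeffCochain])

variable (Y) in
/-- **The rational lattice** `Hᵏ(Y; ℚ) →+ Hᵏ(Y; ℂ)`, `a ↦ a ⊗ 1`: change of coefficients along
`ℚ ↪ ℂ` on classes. [cite: HatcherAT2002, §3.1 p. 198] -/
def ofRatClass (k : ℕ) : singularCohomology ℚ ℚ Y k →+ singularCohomology ℂ ℂ Y k :=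
  coeffClass (R := ℚ) (S := ℂ) (Rat.castHom ℂ).toAddMonoidHom k

/-- `ofRatClass [ζ] = [ζ ⊗ 1]`. [folklore] -/
theorem ofRatClass_π {k : ℕ} (ζ : cocycles ℚ ℚ Y k) :
    ofRatClass Y k (singularCohomology.π ℚ ℚ Y k ζ) =
      singularCohomology.π ℂ ℂ Y k (cocycleOfRat Y k ζ) := by
  rw [ofRatClass, coeffClass_π, cocycleOfRat_eq_coeffCocycle]

/-- **The rational classes are exactly the image of `Hᵏ(Y; ℚ) → Hᵏ(Y; ℂ)`** (the "i.e." of the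
docstring of `IsRationalClass`, at the level of classes). [cite: HatcherAT2002, §3.1 p. 198] -/
theorem isRationalClass_iff_mem_range_ofRatClass {k : ℕ} (c : singularCohomology ℂ ℂ Y k) :
    IsRationalClass c ↔ c ∈ Set.range (ofRatClass Y k) := by
  rw [isRationalClass_iff_exists_cocycleOfRat]
  constructor
  · rintro ⟨ζ, rfl⟩
    exact ⟨singularCohomology.π ℚ ℚ Y k ζ, ofRatClass_π ζ⟩
  · rintro ⟨a, rfl⟩
    induction a using singularCohomology_induction_on with
    | h ζ => exact ⟨ζ, (ofRatClass_π ζ).symm⟩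

/-- The class `a ⊗ 1` of a rational class `a` is rational. [cite: HatcherAT2002, §3.1 p. 198] -/
theorem isRationalClass_ofRatClass {k : ℕ} (a : singularCohomology ℚ ℚ Y k) :
    IsRationalClass (ofRatClass Y k a) :=
  (isRationalClass_iff_mem_range_ofRatClass _).2 ⟨a, rfl⟩

/-- **`Hᵏ(Y; ℚ) → Hᵏ(Y; ℂ)` is injective** (`RationalLattice.π_cocycleOfRat_eq_iff` on classes).
[cite: HatcherAT2002, §3.1 Thm. 3.2 and p. 198] -/
theorem ofRatClass_injective (k : ℕ) : Function.Injective (ofRatClass Y k) := by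
  intro a a' h
  induction a using singularCohomology_induction_on with
  | h ζ =>
    induction a' using singularCohomology_induction_on with
    | h ζ' => rwa [ofRatClass_π, ofRatClass_π, π_cocycleOfRat_eq_iff] at h

/-- **The rational lattice sits in the real lattice**: `a ⊗_ℚ 1 = (a ⊗_ℚ ℝ) ⊗_ℝ 1`, i.e.
`ofRatClass = ofRealClass ∘ (change of coefficients ℚ → ℝ)`. [folklore] -/
theorem ofRatClass_eq_ofRealClass_coeffClass {k : ℕ} (a : singularCohomology ℚ ℚ Y k) :
    ofRatClass Y k a =
      ofRealClass Y k (coeffClass (R := ℚ) (S := ℝ) (Rat.castHom ℝ).toAddMonoidHom k a) := by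
  rw [ofRealClass, ← coeffClass_comp]
  exact coeffClass_congr (fun q ↦ by simp) a

/-- Rational classes are real: `conj (a ⊗ 1) = a ⊗ 1` (cf. `IsRationalClass.conjClass_eq`).
[folklore] -/
@[simp]
theorem conjClass_ofRatClass {k : ℕ} (a : singularCohomology ℚ ℚ Y k) :
    conjClass Y k (ofRatClass Y k a) = ofRatClass Y k a := by
  rw [ofRatClass_eq_ofRealClass_coeffClass, conjClass_ofRealClass]

/-- Rational classes have zero imaginary part. [folklore] -/
@[simp]
theorem imClass_ofRatClass {k : ℕ} (a : singularCohomology ℚ ℚ Y k) :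
    imClass Y k (ofRatClass Y k a) = 0 := by
  rw [ofRatClass_eq_ofRealClass_coeffClass, imClass_ofRealClass]

/-- The real part of a rational class is its real extension `a ⊗_ℚ ℝ`. [folklore] -/
theorem reClass_ofRatClass {k : ℕ} (a : singularCohomology ℚ ℚ Y k) :
    reClass Y k (ofRatClass Y k a) =
      coeffClass (R := ℚ) (S := ℝ) (Rat.castHom ℝ).toAddMonoidHom k a := by
  rw [ofRatClass_eq_ofRealClass_coeffClass, reClass_ofRealClass]

end HodgeTheory

end Literature.AlgebraicGeometry.HodgeTheory

end
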